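import Literature.NumberTheory.Sieve.BatemanHorn
import Literature.NumberTheory.LFunctions.MertensConstant
import HarnessLib

/-!
# Mertens for `ρ_g` over primes in windows, upper-bound form
# (anchor A of the line `rough-relaxed-divisor-sieve`)

Route `RoughValueTransport`, crux `BalancedSemiprimeLayer` (item stmt-Parity-9469), line
`rough-relaxed-divisor-sieve`, anchor A (`stub_rhoPrimeWindowSum`) of the skeleton
`Lines/rough_relaxed_divisor_sieve_c1.lean` (companion lead c1).

For a single integer polynomial `g` write `ρ(p) = polyRootCountMod ![g] p` (the number of roots of
`g` modulo `p`).  If the ordered Bateman–Horn partial products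
`BHP(y) = ∏_{p ≤ y} (1 - 1/p)⁻¹ (1 - ρ(p)/p)` of the one-member system `![g]` converge to a limit
`C > 0` and `ρ(p) < p` for every prime `p`, then for every `θ > 0` there is `u₀` such that for all
`u₀ ≤ u ≤ v`

`∑_{u < p ≤ v} ρ(p)/p ≤ log (log v / log u) + θ`.

This is the Mertens-type input controlling the size `X = x · ∑_m ρ(m)/m` of the weighted line that
the lever of the line sieves.

Proof.  With `M(y) = log y · ∏_{p ≤ y} (1 - 1/p) → e^{-γ}` (Mertens' theorem, tree:
`Literature.NumberTheory.LFunctions.Mertens.tendsto_log_mul_prod_one_sub_inv_nat`) one has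
`∏_{p ≤ y} (1 - ρ(p)/p) = BHP(y) · M(y) / log y`, hence, by `t ≤ -log (1 - t)` for `t < 1`,
`∑_{u < p ≤ v} ρ(p)/p ≤ (log BHP(u) - log BHP(v)) + (log M(u) - log M(v)) + log (log v / log u)`,
and both differences are `< θ/2` for large `u ≤ v` since `log BHP → log C` and `log M → -γ`.
-/

noncomputable section

open Polynomial Filter Finset
open Literature.NumberTheory.Sieve
open scoped Topology

namespace Summit.Parity.BatemanHorn.Cruxes.BalancedSemiprimeLayer.RoughRelaxedDivisorSieve

/-- For a prime `p` with `ρ(p) < p` the local factor `1 - ρ(p)/p` is positive. [folklore] -/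
private theorem one_sub_rho_div_pos {g : ℤ[X]} {p : ℕ} (hp : p.Prime)
    (hlt : polyRootCountMod ![g] p < p) :
    0 < 1 - (polyRootCountMod ![g] p : ℝ) / p := by
  have hp0 : (0 : ℝ) < p := by exact_mod_cast hp.pos
  rw [sub_pos, div_lt_one hp0]
  exact_mod_cast hlt

/-- For a prime `p` the Mertens factor `1 - 1/p` is positive. [folklore] -/
private theorem one_sub_inv_pos {p : ℕ} (hp : p.Prime) : 0 < 1 - (p : ℝ)⁻¹ := by
  have hp1 : (1 : ℝ) < p := by exact_mod_cast hp.one_lt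
  rw [sub_pos]
  exact inv_lt_one_of_one_lt₀ hp1

/-- `BHP(y) · ∏_{p ≤ y} (1 - 1/p) = ∏_{p ≤ y} (1 - ρ(p)/p)` for the one-member system `![g]`.
[folklore] -/
private theorem bhp_mul_prod (g : ℤ[X]) (y : ℕ) :
    batemanHornPartial ![g] y * ∏ p ∈ Nat.primesLE y, (1 - (p : ℝ)⁻¹) =
      ∏ p ∈ Nat.primesLE y, (1 - (polyRootCountMod ![g] p : ℝ) / p) := by
  unfold batemanHornPartial
  rw [← prod_mul_distrib]
  refine prod_congr rfl fun p hp ↦ ?_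
  have h0 : (1 - (p : ℝ)⁻¹) ≠ 0 := (one_sub_inv_pos (Nat.mem_primesLE.mp hp).2).ne'
  rw [Fintype.card_fin, pow_one, one_div, mul_right_comm, inv_mul_cancel₀ h0, one_mul]

/-- Splitting a sum over the primes `≤ v` at `u ≤ v` into the primes `≤ u` and the primes of the
window `(u, v]`. [folklore] -/
private theorem sum_primesLE_split (f : ℕ → ℝ) {u v : ℕ} (huv : u ≤ v) :
    ∑ p ∈ Nat.primesLE v, f p =
      ∑ p ∈ Nat.primesLE u, f p + ∑ p ∈ (Ioc u v).filter Nat.Prime, f p := by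
  rw [Nat.primesLE_eq_filter_Ioc_zero, Nat.primesLE_eq_filter_Ioc_zero, ← sum_union,
    ← filter_union, Ioc_union_Ioc_eq_Ioc (Nat.zero_le u) huv]
  exact disjoint_filter_filter (Ioc_disjoint_Ioc_of_le le_rfl)

/-- `∑_{p ≤ y} log (1 - ρ(p)/p) = log BHP(y) + log M(y) - log log y` for `y ≥ 2`, where
`M(y) = log y · ∏_{p ≤ y} (1 - 1/p)`. [folklore] -/
private theorem sum_log_eq (g : ℤ[X]) (hlt : ∀ p : ℕ, p.Prime → polyRootCountMod ![g] p < p)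
    {y : ℕ} (hy : 2 ≤ y) :
    ∑ p ∈ Nat.primesLE y, Real.log (1 - (polyRootCountMod ![g] p : ℝ) / p) =
      Real.log (batemanHornPartial ![g] y) +
        Real.log (Real.log y * ∏ p ∈ Nat.primesLE y, (1 - (p : ℝ)⁻¹)) -
          Real.log (Real.log y) := by
  have hQ : 0 < ∏ p ∈ Nat.primesLE y, (1 - (p : ℝ)⁻¹) :=
    prod_pos fun p hp ↦ one_sub_inv_pos (Nat.mem_primesLE.mp hp).2
  have hP : 0 < ∏ p ∈ Nat.primesLE y, (1 - (polyRootCountMod ![g] p : ℝ) / p) :=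
    prod_pos fun p hp ↦
      one_sub_rho_div_pos (Nat.mem_primesLE.mp hp).2 (hlt p (Nat.mem_primesLE.mp hp).2)
  have hlog : 0 < Real.log y := Real.log_pos (by exact_mod_cast hy)
  have hB : 0 < batemanHornPartial ![g] y := by
    rw [← bhp_mul_prod] at hP
    exact pos_of_mul_pos_left hP hQ.le
  rw [← Real.log_prod fun p hp ↦
      (one_sub_rho_div_pos (Nat.mem_primesLE.mp hp).2 (hlt p (Nat.mem_primesLE.mp hp).2)).ne',
    ← bhp_mul_prod, Real.log_mul hB.ne' hQ.ne', Real.log_mul hlog.ne' hQ.ne']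
  ring

/-- **Anchor A `stub_rhoPrimeWindowSum`** — Mertens for `ρ_g` over primes, UPPER-bound window form:
if the Bateman–Horn partial products of `![g]` converge to `C > 0` and `ρ_g(p) < p` for every prime
`p`, then for every `θ > 0`, all large `u` and all `v ≥ u`,
`∑_{u < p ≤ v} ρ_g(p)/p ≤ log (log v / log u) + θ` (Mertens' theorem for the roots of `g`, in the
form that needs only the convergence of the Bateman–Horn product to a positive limit). [folklore] -/
theorem stub_rhoPrimeWindowSum :
    ∀ (g : ℤ[X]) (C : ℝ), 0 < C → HasBatemanHornConst ![g] C →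
      (∀ p : ℕ, p.Prime → polyRootCountMod ![g] p < p) →
      ∀ θ : ℝ, 0 < θ → ∃ u₀ : ℕ, ∀ u v : ℕ, u₀ ≤ u → u ≤ v →
        (∑ p ∈ (Ioc u v).filter Nat.Prime, (polyRootCountMod ![g] p : ℝ) / p) ≤
          Real.log (Real.log v / Real.log u) + θ := by
  intro g C hC hBH hlt θ hθ
  have h1 : Tendsto (fun y : ℕ ↦ Real.log (batemanHornPartial ![g] y)) atTop
      (𝓝 (Real.log C)) := hBH.log hC.ne'
  have h2 : Tendsto
      (fun y : ℕ ↦ Real.log (Real.log y * ∏ p ∈ Nat.primesLE y, (1 - (p : ℝ)⁻¹))) atTop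
      (𝓝 (Real.log (Real.exp (-Real.eulerMascheroniConstant)))) :=
    Literature.NumberTheory.LFunctions.Mertens.tendsto_log_mul_prod_one_sub_inv_nat.log
      (Real.exp_pos _).ne'
  have hθ4 : 0 < θ / 4 := by positivity
  obtain ⟨N₁, hN₁⟩ := Metric.tendsto_atTop.mp h1 (θ / 4) hθ4
  obtain ⟨N₂, hN₂⟩ := Metric.tendsto_atTop.mp h2 (θ / 4) hθ4
  refine ⟨max 2 (max N₁ N₂), fun u v hu huv ↦ ?_⟩
  have hu2 : 2 ≤ u := le_trans (le_max_left _ _) hu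
  have huN₁ : N₁ ≤ u := le_trans ((le_max_left _ _).trans (le_max_right _ _)) hu
  have huN₂ : N₂ ≤ u := le_trans ((le_max_right _ _).trans (le_max_right _ _)) hu
  have hv2 : 2 ≤ v := hu2.trans huv
  have hBu := abs_lt.mp (Real.dist_eq _ _ ▸ hN₁ u huN₁)
  have hBv := abs_lt.mp (Real.dist_eq _ _ ▸ hN₁ v (huN₁.trans huv))
  have hMu := abs_lt.mp (Real.dist_eq _ _ ▸ hN₂ u huN₂)
  have hMv := abs_lt.mp (Real.dist_eq _ _ ▸ hN₂ v (huN₂.trans huv))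
  -- termwise `t ≤ -log (1 - t)`
  have hterm : ∀ p ∈ (Ioc u v).filter Nat.Prime,
      (polyRootCountMod ![g] p : ℝ) / p ≤
        -Real.log (1 - (polyRootCountMod ![g] p : ℝ) / p) := by
    intro p hp
    have hp' := (mem_filter.mp hp).2
    have := Real.log_le_sub_one_of_pos (one_sub_rho_div_pos hp' (hlt p hp'))
    linarith
  have hsum := sum_le_sum hterm
  rw [sum_neg_distrib] at hsum
  -- the window sum of logarithms is a difference of two full sums
  have hsplit :=
    sum_primesLE_split (fun p ↦ Real.log (1 - (polyRootCountMod ![g] p : ℝ) / p)) huv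
  rw [sum_log_eq g hlt hv2, sum_log_eq g hlt hu2] at hsplit
  have hlogu : 0 < Real.log u := Real.log_pos (by exact_mod_cast hu2)
  have hlogv : 0 < Real.log v := Real.log_pos (by exact_mod_cast hv2)
  rw [Real.log_div hlogv.ne' hlogu.ne']
  linarith [hBu.1, hBu.2, hBv.1, hBv.2, hMu.1, hMu.2, hMv.1, hMv.2]

end Summit.Parity.BatemanHorn.Cruxes.BalancedSemiprimeLayer.RoughRelaxedDivisorSieve

end
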